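import Summits.QuantumFields.BalabanUV.Beta.GAN24.FaceWordEEZero
import Summits.QuantumFields.BalabanUV.Beta.GAN24.FaceWordSwapGeneric

/-!
# `BalabanUV.Beta.GAN24.FaceWordEESwapZero` — binder row G-an2-4 ∕ (CONV-C), W-slot (α-0), typer's PART VI row **T6-VAL**, the (γ) hand's letter **K7-0 (E⊗E sector at LEVEL `0`):
# THE SWAPPED WORD** — leaf-02 Part 45 `faceWord_swap_eq`'s output word `((S^E_0 ν t ∘ X̃♮_0) ∘ S^E_0 μ rr)` for the level-`0` E-sector table `S^E_0 = unitS sf sm (cE • wilsonA d)` at the deep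
# period `Lc·N`, VALUED: `K_E²·(−½)(½)·sf²·( wVH_0⁻¹⟨q^{(Lc·N)}_{να}, E2_0 q^{(Lc·N)}_{μβ}⟩_{box(Lc·N)} − wVH_0⁻¹·Lc^{d+1}Lc^{d+1}·⟨q^{(N)}_{να}, E2_1 q^{(N)}_{μβ}⟩_{box N} )` (`ν ≠ α`, `μ ≠ β`),
# and `= 0` for `ν = α` ∕ `μ = β` — g56's `FaceWordEESwapDeep` §2 with `j + 1 ↦ 0` (this lineage's generic `FaceWordSwapGeneric.swapWord_eq_directWord` ⨾ `FaceWordEEZero`)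
# (G-an2-4 CRUX TEAM (2), seat `b2b-balaban-gan24-formalise-leaf-06` = the (γ) hand, gen 57; journal [GAN24LEAF06-G57-INTENT-4])

NOT IN PRINT; OUR BOOKKEEPING ([folklore] BY NAME over this lineage's `FaceWordSwapGeneric.swapWord_eq_directWord` and `FaceWordEEZero`; 0 `def`, 0 cited fact, 0 `def … : Prop`, 0 sorry).
HONEST FRAMING (cell contract, verbatim): «discharging `BetaPertH` makes Bałaban's UV stability UNCONDITIONAL — a real constructive-QFT result; it is NOT the continuum
limit and NOT the Clay problem.»  HONEST DEPENDENCY (verbatim): «continuum YM on T⁴ ⇐ BetaPertH ∧ nine spine estimates (0/9 proved); BetaPertH ⇐ (D1) ∧ (D4) ∧ CAP+tail;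
G-an2-4 gates asym, D1 and NE2/3/4.»

WHAT ([folklore]): **`faceWordEE_swap_zero_value`** (`ν ≠ α`, `μ ≠ β`), `faceWordEE_swap_zero_eq_zero_of_left_diag` (`ν = α`), `faceWordEE_swap_zero_eq_zero_of_right_diag` (`μ = β`).  With
`FaceWordEEZero.faceWordEE_zero_value` BOTH exchange face words of Part 47's three are valued at LEVEL `0` on every index pattern; the W-word and the response words are leaf-02's
48∕50b∕P41 (every level); the `LS`∕`FFsym` assembly with Part 47's scalar is the adapter, NOT here.  Asserts NO value of Bałaban's tables beyond these identities; discharges NOTHING of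
`hX` ∕ `hXu` ∕ (C)_{≥1} ∕ `hB0` ∕ `hBF` ∕ (Q-L); NEVER «G-an2-4 closed» as (CONV-C); NOT D1, NOT `BetaPertH`, NOT continuum, NOT Clay.  2026-08-24; no existing file touched.
-/

noncomputable section

open Finset
open scoped BigOperators
open Literature.MathematicalPhysics.QuantumFieldTheory
open Literature.MathematicalPhysics.QuantumFieldTheory.Balaban1983to89
open Literature.MathematicalPhysics.QuantumFieldTheory.Balaban1983to89.Beta
open ExpKernelCalculus (Site MKer Decays BiLoc shiftK comp)
open OneStepResolventKernel (Fib LocStencil)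
open OneStepKernelFamily (KInvStep)
open StepJetData (wilsonA)
open AffineAveraging (box toSite)
open BalabanStepJetsSucc (E2 wVH)
open Summit.QuantumFields.BalabanUV.Beta.AxialDressingRooted (coDressKBmAt one_le_of_neZero)
open Summit.QuantumFields.BalabanUV.Beta.HessKerDressedUnits (unitK unitS)
open Summit.QuantumFields.BalabanUV.Beta.GAN24.FaceWordSwapGeneric (swapWord_eq_directWord)
open Summit.QuantumFields.BalabanUV.Beta.GAN24.FaceWordEEZero (sectorE0_translate exists_common_rate0 dressedStep_invariant_deep0 faceWordEE_zero_value
  faceWordEE_zero_eq_zero_of_right_diag faceWordEE_zero_eq_zero_of_left_diag)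

namespace Summit.QuantumFields.BalabanUV.Beta.GAN24.FaceWordEESwapZero

variable {d : ℕ} {Lc : ℕ} [NeZero Lc] {r : Fin (d + 1) → ℕ}

/-- NOT IN PRINT; OUR BOOKKEEPING.  **THE SWAPPED LEVEL-`0` E⊗E FACE WORD AT THE DEEP PERIOD, VALUED** (`ν ≠ α`, `μ ≠ β`). -/
theorem faceWordEE_swap_zero_value (hr : r ∈ box (d + 1) Lc) (sf sm cE : ℝ) (N : ℕ) [NeZero N] {μ α ν β : Fin (d + 1)} (hνα : ν ≠ α) (hμβ : μ ≠ β) :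
    ∑ rr ∈ box (d + 1) (Lc * N), ∑' t : Site (d + 1),
        (if toSite rr μ % ((Lc * N : ℕ) : ℤ) = ((Lc * N : ℕ) : ℤ) - 1 then (1 : ℝ) else 0) * (if t ν % ((Lc * N : ℕ) : ℤ) = ((Lc * N : ℕ) : ℤ) - 1 then (1 : ℝ) else 0) *
        ∑' yw : Site (d + 1) × Site (d + 1),
          (if yw.1 α % ((Lc * N : ℕ) : ℤ) = ((Lc * N : ℕ) : ℤ) - 1 then (1 : ℝ) else 0) * (if yw.2 β % ((Lc * N : ℕ) : ℤ) = ((Lc * N : ℕ) : ℤ) - 1 then (1 : ℝ) else 0) *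
          comp (comp (unitS sf sm (fun κ u => cE • wilsonA d κ u) ν t)
            (unitK sf sm (coDressKBmAt (toSite r) Lc (KInvStep (d := d) Lc 0))))
            (unitS sf sm (fun κ u => cE • wilsonA d κ u) μ (toSite rr))
            yw.1 yw.2 (Sum.inl α) (Sum.inl β) =
      (((sf * sm)⁻¹ * (sf⁻¹ * sf⁻¹) * cE) * ((sf * sm)⁻¹ * (sf⁻¹ * sf⁻¹) * cE)) *
      ((-(1 / 2 : ℝ)) * (1 / 2 : ℝ) * ((sf * sf) *
        ((wVH d Lc 0)⁻¹ *
            ∑ x ∈ box (d + 1) (Lc * N), ∑ b : Fin (d + 1),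
              ((if b = ν then ((((Lc * N : ℕ) : ℝ))⁻¹ * (((Lc * N : ℕ) : ℝ))⁻¹) * ((((toSite x α % ((Lc * N : ℕ) : ℤ) : ℤ) : ℝ) - ((((Lc * N : ℕ) : ℝ)) - 1) / 2)) else 0)
                + (if b = α then (-(((Lc * N : ℕ) : ℝ))⁻¹ * ((((toSite x ν % ((Lc * N : ℕ) : ℤ) : ℤ) : ℝ) - ((((Lc * N : ℕ) : ℝ)) - 1) / 2))) *
                    (if toSite x α % ((Lc * N : ℕ) : ℤ) = ((Lc * N : ℕ) : ℤ) - 1 then (1 : ℝ) else 0) else 0)) *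
              ∑' s : Site (d + 1), ∑ b' : Fin (d + 1), E2 d Lc 0 (toSite x) s (Sum.inl b) (Sum.inl b') *
                ((if b' = μ then ((((Lc * N : ℕ) : ℝ))⁻¹ * (((Lc * N : ℕ) : ℝ))⁻¹) * ((((s β % ((Lc * N : ℕ) : ℤ) : ℤ) : ℝ) - ((((Lc * N : ℕ) : ℝ)) - 1) / 2)) else 0)
                  + (if b' = β then (-(((Lc * N : ℕ) : ℝ))⁻¹ * ((((s μ % ((Lc * N : ℕ) : ℤ) : ℤ) : ℝ) - ((((Lc * N : ℕ) : ℝ)) - 1) / 2))) *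
                      (if s β % ((Lc * N : ℕ) : ℤ) = ((Lc * N : ℕ) : ℤ) - 1 then (1 : ℝ) else 0) else 0)) -
          (wVH d Lc 0)⁻¹ * (((Lc : ℝ) ^ (d + 1) * (Lc : ℝ) ^ (d + 1)) *
            ∑ y ∈ box (d + 1) N, ∑ a : Fin (d + 1),
              ((if a = ν then (((N : ℝ))⁻¹ * ((N : ℝ))⁻¹) * ((((toSite y α % (N : ℤ)) : ℤ) : ℝ) - ((N : ℝ) - 1) / 2) else 0)
                + (if a = α then (-((N : ℝ))⁻¹ * ((((toSite y ν % (N : ℤ)) : ℤ) : ℝ) - ((N : ℝ) - 1) / 2)) *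
                    (if toSite y α % (N : ℤ) = (N : ℤ) - 1 then (1 : ℝ) else 0) else 0)) *
              ∑' s : Site (d + 1), ∑ b' : Fin (d + 1), E2 d Lc 1 (toSite y) s (Sum.inl a) (Sum.inl b') *
                ((if b' = μ then (((N : ℝ))⁻¹ * ((N : ℝ))⁻¹) * ((((s β % (N : ℤ)) : ℤ) : ℝ) - ((N : ℝ) - 1) / 2) else 0)
                  + (if b' = β then (-((N : ℝ))⁻¹ * ((((s μ % (N : ℤ)) : ℤ) : ℝ) - ((N : ℝ) - 1) / 2)) *
                      (if s β % (N : ℤ) = (N : ℤ) - 1 then (1 : ℝ) else 0) else 0)))))) := by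
  haveI : NeZero (Lc * N) := ⟨Nat.mul_ne_zero (NeZero.ne Lc) (NeZero.ne N)⟩
  obtain ⟨Cs, CX, m, hm, hS, hX⟩ := exists_common_rate0 (d := d) hr sf sm cE
  rw [swapWord_eq_directWord (N := Lc * N) hS hX hm
      (fun κ t s => sectorE0_translate (d := d) sf sm cE κ t (((Lc * N : ℕ) : ℤ) • s))
      (fun s => dressedStep_invariant_deep0 (r := r) sf sm N s) μ ν α β]
  exact faceWordEE_zero_value hr sf sm cE N hνα hμβ

/-- NOT IN PRINT; OUR BOOKKEEPING.  **THE SWAPPED LEVEL-`0` E⊗E FACE WORD VANISHES FOR `ν = α`** (its left current is diagonal). -/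
theorem faceWordEE_swap_zero_eq_zero_of_left_diag (hr : r ∈ box (d + 1) Lc) (sf sm cE : ℝ) (N : ℕ) [NeZero N] (μ ν β : Fin (d + 1)) :
    ∑ rr ∈ box (d + 1) (Lc * N), ∑' t : Site (d + 1),
        (if toSite rr μ % ((Lc * N : ℕ) : ℤ) = ((Lc * N : ℕ) : ℤ) - 1 then (1 : ℝ) else 0) * (if t ν % ((Lc * N : ℕ) : ℤ) = ((Lc * N : ℕ) : ℤ) - 1 then (1 : ℝ) else 0) *
        ∑' yw : Site (d + 1) × Site (d + 1),
          (if yw.1 ν % ((Lc * N : ℕ) : ℤ) = ((Lc * N : ℕ) : ℤ) - 1 then (1 : ℝ) else 0) * (if yw.2 β % ((Lc * N : ℕ) : ℤ) = ((Lc * N : ℕ) : ℤ) - 1 then (1 : ℝ) else 0) *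
          comp (comp (unitS sf sm (fun κ u => cE • wilsonA d κ u) ν t)
            (unitK sf sm (coDressKBmAt (toSite r) Lc (KInvStep (d := d) Lc 0))))
            (unitS sf sm (fun κ u => cE • wilsonA d κ u) μ (toSite rr))
            yw.1 yw.2 (Sum.inl ν) (Sum.inl β) = 0 := by
  haveI : NeZero (Lc * N) := ⟨Nat.mul_ne_zero (NeZero.ne Lc) (NeZero.ne N)⟩
  obtain ⟨Cs, CX, m, hm, hS, hX⟩ := exists_common_rate0 (d := d) hr sf sm cE
  rw [swapWord_eq_directWord (N := Lc * N) hS hX hm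
      (fun κ t s => sectorE0_translate (d := d) sf sm cE κ t (((Lc * N : ℕ) : ℤ) • s))
      (fun s => dressedStep_invariant_deep0 (r := r) sf sm N s) μ ν ν β]
  exact faceWordEE_zero_eq_zero_of_left_diag hr sf sm cE N ν μ β

/-- NOT IN PRINT; OUR BOOKKEEPING.  **THE SWAPPED LEVEL-`0` E⊗E FACE WORD VANISHES FOR `μ = β`** (its right current is diagonal). -/
theorem faceWordEE_swap_zero_eq_zero_of_right_diag (hr : r ∈ box (d + 1) Lc) (sf sm cE : ℝ) (N : ℕ) [NeZero N] (μ ν α : Fin (d + 1)) :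
    ∑ rr ∈ box (d + 1) (Lc * N), ∑' t : Site (d + 1),
        (if toSite rr μ % ((Lc * N : ℕ) : ℤ) = ((Lc * N : ℕ) : ℤ) - 1 then (1 : ℝ) else 0) * (if t ν % ((Lc * N : ℕ) : ℤ) = ((Lc * N : ℕ) : ℤ) - 1 then (1 : ℝ) else 0) *
        ∑' yw : Site (d + 1) × Site (d + 1),
          (if yw.1 α % ((Lc * N : ℕ) : ℤ) = ((Lc * N : ℕ) : ℤ) - 1 then (1 : ℝ) else 0) * (if yw.2 μ % ((Lc * N : ℕ) : ℤ) = ((Lc * N : ℕ) : ℤ) - 1 then (1 : ℝ) else 0) *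
          comp (comp (unitS sf sm (fun κ u => cE • wilsonA d κ u) ν t)
            (unitK sf sm (coDressKBmAt (toSite r) Lc (KInvStep (d := d) Lc 0))))
            (unitS sf sm (fun κ u => cE • wilsonA d κ u) μ (toSite rr))
            yw.1 yw.2 (Sum.inl α) (Sum.inl μ) = 0 := by
  haveI : NeZero (Lc * N) := ⟨Nat.mul_ne_zero (NeZero.ne Lc) (NeZero.ne N)⟩
  obtain ⟨Cs, CX, m, hm, hS, hX⟩ := exists_common_rate0 (d := d) hr sf sm cE
  rw [swapWord_eq_directWord (N := Lc * N) hS hX hm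
      (fun κ t s => sectorE0_translate (d := d) sf sm cE κ t (((Lc * N : ℕ) : ℤ) • s))
      (fun s => dressedStep_invariant_deep0 (r := r) sf sm N s) μ ν α μ]
  exact faceWordEE_zero_eq_zero_of_right_diag hr sf sm cE N ν α μ

end Summit.QuantumFields.BalabanUV.Beta.GAN24.FaceWordEESwapZero

end
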